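import Mathlib
import Summits.ValiantsHypothesis.ValiantsHypothesis.Theses.RefutationDegree

/-!
# Sketch — first lemmas of the crux-idea cards for `CertWindowQP` (stmt-ValiantsHypothesis-5640)

Card `separating-module-transfer`: `separating_to_certificate`, `generic_equations_exist`.
Card `cayley-hamilton-trace-lift`: `normalForm_transfer`.
Nothing here is proved (sorries); the point is that the statements elaborate over existing declarations.
-/

namespace Summit.ValiantsHypothesis.ValiantsHypothesis.Cruxes.CertWindowQP.Sketch

open scoped BigOperators
open Literature.Computability.AlgebraicComplexity

/-- ring of unknowns of Rep(n,m): entries of `A₀` (tag `none`) and of the `A_e` (tag `some e`). -/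
abbrev U (n m : ℕ) := MvPolynomial (Option (Fin n × Fin n) × (Fin m × Fin m)) ℂ

/-- the symbolic determinant `det(A₀ + Σ_e x_e A_e)` as a polynomial in `x` over the unknowns (the map Φ). -/
noncomputable def detPencil (n m : ℕ) : MvPolynomial (Fin n × Fin n) (U n m) :=
  (Matrix.of fun i j : Fin m =>
      MvPolynomial.C (MvPolynomial.X (none, (i, j))) +
        ∑ e : Fin n × Fin n, MvPolynomial.X e * MvPolynomial.C (MvPolynomial.X (some e, (i, j)))).det

/-- the defect `P = det(A(x)) − per_n(x)`; its `x`-coefficients are the equations of Rep(n,m) (route encoding). -/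
noncomputable def defect (n m : ℕ) : MvPolynomial (Fin n × Fin n) (U n m) :=
  detPencil n m - MvPolynomial.map MvPolynomial.C (perPoly (Fin n) ℂ)

/-- Rep(n,m) has a Nullstellensatz refutation with every product of degree ≤ `D` (route format, cf. `MrCalibration`). -/
def HasNSRefutation (n m D : ℕ) : Prop :=
  ∃ h : ((Fin n × Fin n) →₀ ℕ) → U n m,
    (∀ μ, (h μ * (defect n m).coeff μ).totalDegree ≤ D) ∧
      ∑ μ ∈ (defect n m).support, h μ * (defect n m).coeff μ = 1

/-- FIRST LEMMA (card separating-module-transfer). A polynomial `E` in the coefficient variables `c_μ`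
that vanishes identically on determinantal expressions (`E ∘ Φ ≡ 0` in the unknowns) but not at `per_n`
is turned, by the Hadamard/telescoping identity `E(c) − E(c') = Σ_μ (c_μ − c'_μ) G_μ(c,c')`, into a
Nullstellensatz refutation of Rep(n,m) of degree ≤ `deg E · m`. -/
theorem separating_to_certificate (n m γ : ℕ) (E : MvPolynomial ((Fin n × Fin n) →₀ ℕ) ℂ)
    (hdeg : E.totalDegree ≤ γ)
    (hvanish : MvPolynomial.aeval (fun μ => (detPencil n m).coeff μ) E = 0)
    (hper : MvPolynomial.eval (fun μ => (perPoly (Fin n) ℂ).coeff μ) E ≠ 0) :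
    HasNSRefutation n m (γ * m) := by
  sorry

/-- COUNTING HALF (card separating-module-transfer): nonzero equations of the affine determinantal-expression
variety exist in degree ≤ (n²+1)·m² as soon as there are enough coefficients
(`binom(n²+m, m) > (n²+1) m³`, i.e. all m ≥ n ≥ 3 but (3,3); Chardin/Nesterenko Hilbert-function bound + Bézout `deg ≤ m^dim`).
Consequence: a GENERIC target of degree ≤ m has refutation degree ≤ (n²+1) m³ — the positive horn's scale. -/
theorem generic_equations_exist (n m : ℕ) (hn : 3 ≤ n) (hm : n ≤ m)
    (hroom : (n ^ 2 + 1) * m ^ 3 < Nat.choose (n ^ 2 + m) m) :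
    ∃ E : MvPolynomial ((Fin n × Fin n) →₀ ℕ) ℂ,
      E ≠ 0 ∧ E.totalDegree ≤ (n ^ 2 + 1) * m ^ 2 ∧
        (∀ μ ∈ E.vars, μ.degree ≤ m) ∧
          MvPolynomial.aeval (fun μ => (detPencil n m).coeff μ) E = 0 := by
  sorry

/-! ### Normal form `A₀ = 1` (card cayley-hamilton-trace-lift) -/

/-- unknowns of the normalised system: only the `L_e`. -/
abbrev UL (n m : ℕ) := MvPolynomial ((Fin n × Fin n) × (Fin m × Fin m)) ℂ

/-- `det(1 + Σ_e x_e L_e)` — its `x^μ`-coefficient is the `μ`-component of `e_{|μ|}(L(x))`, a symmetrised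
sum of traces of words of length `|μ|` in the `L_e` (Newton), homogeneous of degree `|μ|`. -/
noncomputable def detUnipotentPencil (n m : ℕ) : MvPolynomial (Fin n × Fin n) (UL n m) :=
  (1 + Matrix.of fun i j : Fin m =>
      ∑ e : Fin n × Fin n, MvPolynomial.X e * MvPolynomial.C (MvPolynomial.X (e, (i, j)))).det

/-- the normalised target `per_n(x + y₀) / per_n(y₀)` at a base point with `per_n(y₀) ≠ 0`. -/
noncomputable def shiftedNormalisedPer (n : ℕ) (y₀ : Fin n × Fin n → ℂ) : MvPolynomial (Fin n × Fin n) ℂ :=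
  MvPolynomial.C (MvPolynomial.eval y₀ (perPoly (Fin n) ℂ))⁻¹ *
    MvPolynomial.aeval (fun e => MvPolynomial.X e + MvPolynomial.C (y₀ e)) (perPoly (Fin n) ℂ)

/-- defect of the normalised system N(n,m,y₀): `det(1 + L(x)) − per(x+y₀)/per(y₀)`. -/
noncomputable def defectN (n m : ℕ) (y₀ : Fin n × Fin n → ℂ) : MvPolynomial (Fin n × Fin n) (UL n m) :=
  detUnipotentPencil n m - MvPolynomial.map MvPolynomial.C (shiftedNormalisedPer n y₀)

/-- N(n,m,y₀) has a Nullstellensatz refutation with every product of degree ≤ `D`. -/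
def HasNSRefutationN (n m : ℕ) (y₀ : Fin n × Fin n → ℂ) (D : ℕ) : Prop :=
  ∃ g : ((Fin n × Fin n) →₀ ℕ) → UL n m,
    (∀ μ, (g μ * (defectN n m y₀).coeff μ).totalDegree ≤ D) ∧
      ∑ μ ∈ (defectN n m y₀).support, g μ * (defectN n m y₀).coeff μ = 1

/-- FIRST LEMMA (card cayley-hamilton-trace-lift). Normal-form transfer: substitute
`L_e := adj(B₀) A_e / per(y₀)` with `B₀ = A(y₀)`; the identities `δ^{m−|μ|} N_μ(adj(B₀)A) = δ^{m−1} Ψ_μ`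
(`δ = det B₀ ≡ per(y₀)` modulo the ideal) carry a degree-`d` refutation of N(n,m,y₀) to a refutation of
Rep(n,m) of degree ≤ `m·d + 2m²`.  So D_Rep and D_N agree up to the polynomial slack CertWindowQP allows. -/
theorem normalForm_transfer (n m d : ℕ) (y₀ : Fin n × Fin n → ℂ)
    (hy : MvPolynomial.eval y₀ (perPoly (Fin n) ℂ) ≠ 0)
    (h : HasNSRefutationN n m y₀ d) :
    HasNSRefutation n m (m * d + 2 * m ^ 2) := by
  sorry

end Summit.ValiantsHypothesis.ValiantsHypothesis.Cruxes.CertWindowQP.Sketch
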